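import Mathlib
import HarnessLib
import Literature.AlgebraicGeometry.Resolution.BlowupRingExceptionalFibre

/-!
# Kollár–Szabó going down, (P2): the quadratic transform modulo the exceptional parameter is a regular
# local ring of smaller dimension (crux `WildQuotients.WildQuotientResolution`, stub `stub_phaseZeroHighDim`)

Crux stmt-ResolutionOfSingularities-15640 (`WildQuotientResolution`), registered stub `stub_phaseZeroHighDim`; programme:
`KollarSzaboGoingDown_holds` via ✓`kollarSzaboGoingDown_of_localStepLE`, item (P2) of memo KS-GOINGDOWN-ASSEMBLY.md: for the
equivariant quadratic transform `R₁ = S[𝔪/t]_𝔫 = LocalSubring.ofPrime (blowupRing S t) 𝔫` (hand 8-g1), the local ring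
`R₁/(t)` of the exceptional divisor `E = Spec (R₁/(t))` at its closed point is REGULAR of dimension `≤ dim S - 1`.
The tree already knows the chart quotient `S[𝔪/t]/(t) ≅ κ(S)[T_j]` is a regular ring
(✓`isRegularRing_blowupRing_quotient`, ✓`blowupRing_chartQuotient_of_not_mem_sq`, `BlowupRingExceptionalFibre.lean`); this file
localises: `R₁/(t)` is the localisation of `S[𝔪/t]/(t)` at the image of `𝔫` (Mathlib's instance "localisation commutes with
quotients", `RingTheory/Localization/Ideal.lean`).

* `algebraMapSubmonoid_quotient_primeCompl_eq` — the image of `𝔫ᶜ` in `T/I` is `(𝔫/I)ᶜ` for `I ≤ 𝔫`;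
* `isRegularLocalRing_localization_quotient` — for `T` with `T/I` a regular ring, `A` a localisation of `T` at a prime `𝔫 ⊇ I`:
  `A ⧸ I·A` is a regular local ring, of dimension `≤ dim (T/I)` (`ringKrullDim_localization_quotient_le`);
* ★ `isRegularLocalRing_ofPrime_blowupRing_quotient`, `ringKrullDim_ofPrime_blowupRing_quotient_le` — the case
  `T = blowupRing S t`, `I = (t)`, `A = LocalSubring.ofPrime T 𝔫`: `R₁/(t)R₁` is regular local with
  `dim ≤ dim S[𝔪/t]/(t) = #{j ≠ 0} = dim S - 1` (`ringKrullDim_blowupRing_quotient`).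

With ✓`isRegularLocalRing_ofPrime_blowupRing` (p828671) this supplies the `E`/`x₁` regularity and dimension clauses of the local
step; the valuation ring at `η = (t)` then comes from ✓`KSGoingDownExceptionalPrime` (prime `(t)` of height one in the regular `R₁`).

[OURS · crux stmt-ResolutionOfSingularities-15640 · helper toward `stub_phaseZeroHighDim` ((P2); NOT a proof of the stub); counted 0;
AI-level work, weaker than expert review.] [cite: StacksProject, Tag 0BIQ]
-/

-- single-problem summit: the doubled namespace component `ResolutionOfSingularities` is forced
set_option linter.dupNamespace false

noncomputable section

open IsLocalRing Literature.AlgebraicGeometry.Resolution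

namespace Summit.ResolutionOfSingularities.ResolutionOfSingularities.Theorems.WildQuotientResolution.KSGoingDown

universe u

/-! ## Localisation commutes with quotients: regularity and dimension -/

section LocQuot

variable {T : Type u} [CommRing T] (I 𝔫 : Ideal T) [𝔫.IsPrime] (hI : I ≤ 𝔫)
  (A : Type u) [CommRing A] [Algebra T A] [IsLocalization.AtPrime A 𝔫]

include hI in
/-- For `I ≤ 𝔫` prime, `𝔫/I` is a prime of `T/I`. [folklore] -/
theorem isPrime_map_quotient_mk : (𝔫.map (Ideal.Quotient.mk I)).IsPrime :=
  Ideal.map_isPrime_of_surjective Ideal.Quotient.mk_surjective (by rwa [Ideal.mk_ker])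

include hI in
/-- For `I ≤ 𝔫`, the image in `T/I` of the complement of `𝔫` is the complement of `𝔫/I`. [folklore] -/
theorem algebraMapSubmonoid_quotient_primeCompl_eq [h : (𝔫.map (Ideal.Quotient.mk I)).IsPrime] :
    Algebra.algebraMapSubmonoid (T ⧸ I) 𝔫.primeCompl = (𝔫.map (Ideal.Quotient.mk I)).primeCompl := by
  have hcomap : (𝔫.map (Ideal.Quotient.mk I)).comap (Ideal.Quotient.mk I) = 𝔫 := by
    rw [Ideal.comap_map_of_surjective _ Ideal.Quotient.mk_surjective, ← RingHom.ker_eq_comap_bot,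
      Ideal.mk_ker, sup_eq_left]
    exact hI
  ext z
  constructor
  · rintro ⟨y, hy, rfl⟩
    change Ideal.Quotient.mk I y ∉ 𝔫.map (Ideal.Quotient.mk I)
    intro hz
    apply hy
    change y ∈ 𝔫
    rw [← hcomap]
    exact Ideal.mem_comap.mpr hz
  · intro hz
    change z ∉ 𝔫.map (Ideal.Quotient.mk I) at hz
    obtain ⟨y, rfl⟩ := Ideal.Quotient.mk_surjective z
    refine ⟨y, ?_, rfl⟩
    change y ∉ 𝔫
    intro hy
    exact hz (Ideal.mem_map_of_mem _ hy)

include hI in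
/-- **Localisation commutes with quotients, regularity**: if `T/I` is a regular ring and `A = T_𝔫` (`I ≤ 𝔫`), then
`A ⧸ I·A ≅ (T/I)_{𝔫/I}` is a regular local ring. [folklore] -/
theorem isRegularLocalRing_localization_quotient [IsRegularRing (T ⧸ I)] :
    IsRegularLocalRing (A ⧸ I.map (algebraMap T A)) := by
  haveI h𝔫' : (𝔫.map (Ideal.Quotient.mk I)).IsPrime := isPrime_map_quotient_mk I 𝔫 hI
  haveI : IsLocalization.AtPrime (A ⧸ I.map (algebraMap T A)) (𝔫.map (Ideal.Quotient.mk I)) := by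
    have h := algebraMapSubmonoid_quotient_primeCompl_eq I 𝔫 hI (h := h𝔫')
    have inst : IsLocalization (Algebra.algebraMapSubmonoid (T ⧸ I) 𝔫.primeCompl)
        (A ⧸ I.map (algebraMap T A)) := inferInstance
    rw [h] at inst
    exact inst
  haveI : IsRegularLocalRing (Localization.AtPrime (𝔫.map (Ideal.Quotient.mk I))) := inferInstance
  exact IsRegularLocalRing.of_ringEquiv
    (IsLocalization.algEquiv (𝔫.map (Ideal.Quotient.mk I)).primeCompl
      (Localization.AtPrime (𝔫.map (Ideal.Quotient.mk I))) (A ⧸ I.map (algebraMap T A))).toRingEquiv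

include hI in
/-- **Localisation commutes with quotients, dimension**: `dim (A ⧸ I·A) ≤ dim (T/I)` for `A = T_𝔫`, `I ≤ 𝔫`. [folklore] -/
theorem ringKrullDim_localization_quotient_le :
    ringKrullDim (A ⧸ I.map (algebraMap T A)) ≤ ringKrullDim (T ⧸ I) := by
  haveI h𝔫' : (𝔫.map (Ideal.Quotient.mk I)).IsPrime := isPrime_map_quotient_mk I 𝔫 hI
  haveI : IsLocalization.AtPrime (A ⧸ I.map (algebraMap T A)) (𝔫.map (Ideal.Quotient.mk I)) := by
    have h := algebraMapSubmonoid_quotient_primeCompl_eq I 𝔫 hI (h := h𝔫')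
    have inst : IsLocalization (Algebra.algebraMapSubmonoid (T ⧸ I) 𝔫.primeCompl)
        (A ⧸ I.map (algebraMap T A)) := inferInstance
    rw [h] at inst
    exact inst
  rw [IsLocalization.AtPrime.ringKrullDim_eq_height (𝔫.map (Ideal.Quotient.mk I)) (A ⧸ I.map (algebraMap T A))]
  exact Ideal.height_le_ringKrullDim_of_ne_top Ideal.IsPrime.ne_top'

end LocQuot

/-! ## The quadratic transform modulo the exceptional parameter -/

section Blowup

variable {K : Type u} [Field K] (S : Subring K) [IsRegularLocalRing S] {t : K} (htS : t ∈ S)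
  (htm : (⟨t, htS⟩ : S) ∈ maximalIdeal S) (ht2 : (⟨t, htS⟩ : S) ∉ maximalIdeal S ^ 2) (ht0 : t ≠ 0)
  (𝔫 : Ideal (blowupRing S t)) [𝔫.IsPrime] (ht𝔫 : (⟨t, le_blowupRing S t htS⟩ : blowupRing S t) ∈ 𝔫)

include htm ht2 ht0 ht𝔫 in
/-- ★ **`R₁/(t)R₁` is a regular local ring** for `R₁ = S[𝔪/t]_𝔫 = LocalSubring.ofPrime (blowupRing S t) 𝔫`, `S ⊆ K`
regular local, `t ∈ 𝔪 ∖ 𝔪²`, `𝔫` a prime of the chart containing `t` (e.g. the chart origin of the equivariant quadratic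
transform). [cite: StacksProject, Tag 0BIQ] -/
theorem isRegularLocalRing_ofPrime_blowupRing_quotient :
    IsRegularLocalRing ((LocalSubring.ofPrime (blowupRing S t) 𝔫).toSubring ⧸
      (Ideal.span {(⟨t, le_blowupRing S t htS⟩ : blowupRing S t)}).map
        (algebraMap (blowupRing S t) (LocalSubring.ofPrime (blowupRing S t) 𝔫).toSubring)) := by
  haveI := isRegularRing_blowupRing_quotient S htS htm ht2 ht0
  exact isRegularLocalRing_localization_quotient _ 𝔫 ((Ideal.span_singleton_le_iff_mem _).mpr ht𝔫) _

include ht𝔫 in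
/-- `dim R₁/(t)R₁ ≤ dim S[𝔪/t]/(t)`. [folklore] -/
theorem ringKrullDim_ofPrime_blowupRing_quotient_le :
    ringKrullDim ((LocalSubring.ofPrime (blowupRing S t) 𝔫).toSubring ⧸
      (Ideal.span {(⟨t, le_blowupRing S t htS⟩ : blowupRing S t)}).map
        (algebraMap (blowupRing S t) (LocalSubring.ofPrime (blowupRing S t) 𝔫).toSubring)) ≤
      ringKrullDim (blowupRing S t ⧸ Ideal.span {(⟨t, le_blowupRing S t htS⟩ : blowupRing S t)}) :=
  ringKrullDim_localization_quotient_le _ 𝔫 ((Ideal.span_singleton_le_iff_mem _).mpr ht𝔫) _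

include htm ht2 ht0 in
/-- **`dim S[𝔪/t]/(t) = dim S - 1`** (precisely `#{j : Fin d // j ≠ 0}` with `d` the embedding dimension = `dim S`): the chart
quotient is the polynomial ring `κ(S)[T_j : j ≠ 0]` (✓`blowupRing_chartQuotient_of_not_mem_sq`). [cite: StacksProject, Tag 0BIQ] -/
theorem ringKrullDim_blowupRing_quotient {d : ℕ} (hd : (maximalIdeal S).spanFinrank = d) (hd0 : 0 < d) :
    ringKrullDim (blowupRing S t ⧸ Ideal.span {(⟨t, le_blowupRing S t htS⟩ : blowupRing S t)}) =
      Nat.card {j : Fin d // j ≠ ⟨0, hd0⟩} := by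
  obtain ⟨ψ, hψ, -⟩ := blowupRing_chartQuotient_of_not_mem_sq S hd htS htm ht2 ht0 hd0
  rw [← ringKrullDim_eq_of_ringEquiv (RingEquiv.ofBijective ψ hψ), MvPolynomial.ringKrullDim_of_isNoetherianRing,
    ringKrullDim_eq_zero_of_isField (Field.toIsField _), zero_add]

end Blowup

end Summit.ResolutionOfSingularities.ResolutionOfSingularities.Theorems.WildQuotientResolution.KSGoingDown

end
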